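import Mathlib
import Summits.MatrixMultiplication.MatrixMultiplication.Theorems.FidelityWitnessesFidelityThesisSepMajorantSingleProduct

/-!
# Line `separable-majorant` for crux `FidelityWitnesses.FidelityThesis` (stmt-MatrixMultiplication-4956) —
stub `stub_flipBessel`: the middle-index FLIP has Frobenius mass `≤ k·k'` in an orthonormal product system

Slots `b = (κ,μ)`, `c = (μ',ν)` in `Fin n × Fin n`.  Let `a_1,…,a_k` and `b'_1,…,b'_{k'}` be orthonormal
families of `ℂ^{n×n}` (`Σ_b conj (a_i b) a_{i'} b = [i = i']`, likewise for `b'`).  The matrix of the flip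
`μ ↔ μ'` of the two middle indices of `ℂ^{n×n} ⊗ ℂ^{n×n}`, taken in the product system, is
`M_{(i,j),(i',j')} = Σ_{κ ν μ μ'} a_i(κ,μ) b'_j(μ,ν) conj (a_{i'}(κ,μ')) conj (b'_{j'}(μ',ν))`, and this stub is
`‖M‖_F² = Σ_{q,q'} |M_{q,q'}|² ≤ k·k'` (consumed by `stub_capBound` as hypothesis `hM` in the lead's
`fidelity_le_rpow_threeHalves`).

Proof (Bessel).  On `D := (Fin n × Fin n) × (Fin n × Fin n)`, points `x = ((κ,μ'),(μ,ν))`, put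
`F_{(i',j)}(x) := a_{i'}(κ,μ') · conj b'_j(μ,ν)` and `X_{(i,j')}(x) := a_i(κ,μ) · conj b'_{j'}(μ',ν)`.  Then
`M_{(i,j),(i',j')} = ⟨F_{(i',j)}, X_{(i,j')}⟩ = Σ_x conj (F x) · X x`; the family `F` is orthonormal
(`⟨F_p, F_{p'}⟩ = [p.1 = p'.1]·[p.2 = p'.2]`) and each `X_{(i,j')}` is a unit vector
(`‖X‖² = ‖a_i‖² ‖b'_{j'}‖² = 1`).  Bessel's inequality (Mathlib's `Orthonormal.sum_inner_products_le`,
transported to coordinates through `EuclideanSpace ℂ D`) gives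
`Σ_{(i',j)} |⟨F_{(i',j)}, X_{(i,j')}⟩|² ≤ ‖X_{(i,j')}‖² = 1` for each of the `k·k'` pairs `(i,j')`; summing over
them gives `k·k'`.  Supports item `stmt-MatrixMultiplication-4956`; no definitions; imports toolkit I only.
-/

namespace Summit.MatrixMultiplication.MatrixMultiplication.Theorems

open scoped BigOperators ComplexConjugate InnerProductSpace
open Literature.Computability.AlgebraicComplexity

/-- Bessel's inequality in coordinates for a doubly-indexed orthonormal family: if
`F : Fin k × Fin k' → D → ℂ` satisfies `Σ_x conj (F p x) F p' x = [p = p']`, then for every `Y : D → ℂ`,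
`Σ_{i'} Σ_j |Σ_x conj (F (i',j) x) Y x|² ≤ Σ_x |Y x|²` (Mathlib's `Orthonormal.sum_inner_products_le` in
`EuclideanSpace ℂ D`). [folklore] -/
theorem sepMajorantFB_bessel {k k' : ℕ} {D : Type*} [Fintype D] (F : Fin k × Fin k' → D → ℂ)
    (hF : ∀ p p' : Fin k × Fin k', (∑ x, conj (F p x) * F p' x) = if p = p' then 1 else 0)
    (Y : D → ℂ) :
    ∑ i' : Fin k, ∑ j : Fin k', ‖∑ x, conj (F (i', j) x) * Y x‖ ^ 2 ≤ ∑ x, ‖Y x‖ ^ 2 := by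
  -- adapted from `SevenEighthsLaw.stub_capEasyRegime_bessel`
  -- (Theorems/FidelityWitnessesSevenEighthsLawStubCapEasyRegime)
  let E : Fin k × Fin k' → EuclideanSpace ℂ D := fun p => WithLp.toLp 2 (F p)
  let G : EuclideanSpace ℂ D := WithLp.toLp 2 Y
  have hE : Orthonormal ℂ E := by
    rw [orthonormal_iff_ite]
    intro p p'
    rw [← hF p p']
    simp only [E, PiLp.inner_apply, RCLike.inner_apply']
  have hB := hE.sum_inner_products_le G (s := Finset.univ)
  have hG : ‖G‖ ^ 2 = ∑ x, ‖Y x‖ ^ 2 := by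
    rw [EuclideanSpace.norm_sq_eq]
  have hI : ∀ p, ⟪E p, G⟫_ℂ = ∑ x, conj (F p x) * Y x := by
    intro p
    simp only [E, G, PiLp.inner_apply, RCLike.inner_apply']
  calc ∑ i' : Fin k, ∑ j : Fin k', ‖∑ x, conj (F (i', j) x) * Y x‖ ^ 2
      = ∑ p : Fin k × Fin k', ‖⟪E p, G⟫_ℂ‖ ^ 2 := by
        rw [Fintype.sum_prod_type (f := fun p : Fin k × Fin k' => ‖⟪E p, G⟫_ℂ‖ ^ 2)]
        simp only [hI]
    _ ≤ ‖G‖ ^ 2 := hB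
    _ = ∑ x, ‖Y x‖ ^ 2 := hG

/-- **Stub `stub_flipBessel` (Frobenius mass of the middle-index flip, `≤ k·k'`).**  For orthonormal
families `a : Fin k → ℂ^{n×n}` and `b' : Fin k' → ℂ^{n×n}`, the matrix
`M_{(i,j),(i',j')} = Σ_{κ ν μ μ'} a_i(κ,μ) b'_j(μ,ν) conj (a_{i'}(κ,μ')) conj (b'_{j'}(μ',ν))` of the flip
`μ ↔ μ'` in the product system `{a_i ⊗ conj b'_j}` has `Σ_{q,q'} |M_{q,q'}|² ≤ k·k'`: for fixed `(i,j')` the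
entries are the inner products of the unit vector `X_{(i,j')} = a_i(κ,μ) conj b'_{j'}(μ',ν)` against the
orthonormal family `F_{(i',j)} = a_{i'}(κ,μ') conj b'_j(μ,ν)` on `(Fin n × Fin n) × (Fin n × Fin n)`, so
Bessel bounds their squared sum by `1`; summing over the `k·k'` pairs `(i,j')` gives the claim. [folklore] -/
theorem stub_flipBessel {n k k' : ℕ} (a : Fin k → Fin n × Fin n → ℂ) (b' : Fin k' → Fin n × Fin n → ℂ)
    (ha : ∀ i i' : Fin k, (∑ b, conj (a i b) * a i' b) = if i = i' then 1 else 0)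
    (hb : ∀ j j' : Fin k', (∑ c, conj (b' j c) * b' j' c) = if j = j' then 1 else 0) :
    ∑ q : Fin k × Fin k', ∑ q' : Fin k × Fin k',
      ‖∑ κ : Fin n, ∑ ν : Fin n, ∑ μ : Fin n, ∑ μ' : Fin n,
        a q.1 (κ, μ) * b' q.2 (μ, ν) * conj (a q'.1 (κ, μ')) * conj (b' q'.2 (μ', ν))‖ ^ 2 ≤
      (k : ℝ) * (k' : ℝ) := by
  -- (1) the two families on `D = (Fin n × Fin n) × (Fin n × Fin n)`, points `x = ((κ,μ'),(μ,ν))`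
  obtain ⟨F, hF⟩ : ∃ F : Fin k × Fin k' → (Fin n × Fin n) × (Fin n × Fin n) → ℂ,
      ∀ p x, F p x = a p.1 x.1 * conj (b' p.2 x.2) := ⟨_, fun _ _ => rfl⟩
  obtain ⟨X, hX⟩ : ∃ X : Fin k × Fin k' → (Fin n × Fin n) × (Fin n × Fin n) → ℂ,
      ∀ p x, X p x = a p.1 (x.1.1, x.2.1) * conj (b' p.2 (x.1.2, x.2.2)) := ⟨_, fun _ _ => rfl⟩
  -- (2) the summand of the goal is the inner product `⟨F (i',j), X (i,j')⟩`
  have hflip : ∀ f : Fin n → Fin n → Fin n → Fin n → ℂ,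
      (∑ κ, ∑ ν, ∑ μ, ∑ μ', f κ ν μ μ') =
        ∑ x : (Fin n × Fin n) × (Fin n × Fin n), f x.1.1 x.2.2 x.2.1 x.1.2 := by
    intro f
    simp only [Fintype.sum_prod_type]
    refine Finset.sum_congr rfl fun κ _ => ?_
    calc (∑ ν, ∑ μ, ∑ μ', f κ ν μ μ') = ∑ μ, ∑ ν, ∑ μ', f κ ν μ μ' := Finset.sum_comm
      _ = ∑ μ, ∑ μ', ∑ ν, f κ ν μ μ' := Finset.sum_congr rfl fun μ _ => Finset.sum_comm
      _ = ∑ μ', ∑ μ, ∑ ν, f κ ν μ μ' := Finset.sum_comm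
  have hid : ∀ q q' : Fin k × Fin k',
      (∑ κ : Fin n, ∑ ν : Fin n, ∑ μ : Fin n, ∑ μ' : Fin n,
        a q.1 (κ, μ) * b' q.2 (μ, ν) * conj (a q'.1 (κ, μ')) * conj (b' q'.2 (μ', ν))) =
      ∑ x, conj (F (q'.1, q.2) x) * X (q.1, q'.2) x := by
    intro q q'
    rw [hflip (fun κ ν μ μ' =>
      a q.1 (κ, μ) * b' q.2 (μ, ν) * conj (a q'.1 (κ, μ')) * conj (b' q'.2 (μ', ν)))]
    refine Finset.sum_congr rfl ?_
    rintro ⟨⟨κ, μ'⟩, ⟨μ, ν⟩⟩ -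
    simp only [hF, hX, map_mul, Complex.conj_conj]
    ring
  -- (3) `F` is orthonormal (from `ha`, `hb`)
  have hFon : ∀ p p' : Fin k × Fin k', (∑ x, conj (F p x) * F p' x) = if p = p' then 1 else 0 := by
    rintro ⟨i, j⟩ ⟨i', j'⟩
    have h1 : (∑ x, conj (F (i, j) x) * F (i', j') x) =
        (∑ y, conj (a i y) * a i' y) * ∑ z, conj (b' j' z) * b' j z := by
      rw [Fintype.sum_prod_type, Finset.sum_mul_sum]
      refine Finset.sum_congr rfl fun y _ => Finset.sum_congr rfl fun z _ => ?_
      simp only [hF, map_mul, Complex.conj_conj]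
      ring
    rw [h1, ha i i', hb j' j]
    by_cases hi : i = i'
    · by_cases hj : j' = j
      · rw [if_pos hi, if_pos hj, one_mul, if_pos (Prod.ext hi hj.symm)]
      · have hne : (i, j) ≠ (i', j') := fun h => hj (Prod.mk.inj h).2.symm
        rw [if_pos hi, if_neg hj, mul_zero, if_neg hne]
    · have hne : (i, j) ≠ (i', j') := fun h => hi (Prod.mk.inj h).1
      rw [if_neg hi, zero_mul, if_neg hne]
  -- (4) each `X (i,j')` is a unit vector (from `ha i i`, `hb j' j'`)
  have hunit : ∀ v : Fin n × Fin n → ℂ, (∑ y, conj (v y) * v y) = 1 → (∑ y, ‖v y‖ ^ 2) = 1 := by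
    intro v hv
    simp_rw [Complex.conj_mul'] at hv
    exact_mod_cast hv
  have hXn : ∀ (i : Fin k) (j' : Fin k'), (∑ x, ‖X (i, j') x‖ ^ 2) = 1 := by
    intro i j'
    have hA : (∑ y, ‖a i y‖ ^ 2) = 1 := hunit (a i) (by rw [ha i i, if_pos rfl])
    have hB : (∑ z, ‖b' j' z‖ ^ 2) = 1 := hunit (b' j') (by rw [hb j' j', if_pos rfl])
    calc (∑ x, ‖X (i, j') x‖ ^ 2) = (∑ y, ‖a i y‖ ^ 2) * ∑ z, ‖b' j' z‖ ^ 2 := by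
          rw [Fintype.sum_prod_type (f := fun y => ‖a i y‖ ^ 2),
            Fintype.sum_prod_type (f := fun z => ‖b' j' z‖ ^ 2), Finset.sum_mul_sum]
          simp only [Fintype.sum_prod_type]
          refine Finset.sum_congr rfl fun κ _ => Finset.sum_congr rfl fun μ' _ => ?_
          rw [Finset.sum_mul_sum]
          refine Finset.sum_congr rfl fun μ _ => Finset.sum_congr rfl fun ν _ => ?_
          simp only [hX, norm_mul, mul_pow, Complex.norm_conj]
      _ = 1 := by rw [hA, hB, one_mul]
  -- (5) reorder `Σ_{(i,j)} Σ_{(i',j')}` as `Σ_i Σ_{j'} Σ_{i'} Σ_j`, then Bessel for each `(i,j')`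
  have hreindex : ∀ g : Fin k × Fin k' → Fin k × Fin k' → ℝ,
      (∑ q, ∑ q', g q q') = ∑ i, ∑ j', ∑ i', ∑ j, g (i, j) (i', j') := by
    intro g
    simp only [Fintype.sum_prod_type]
    refine Finset.sum_congr rfl fun i _ => ?_
    calc (∑ j, ∑ i', ∑ j', g (i, j) (i', j')) = ∑ j, ∑ j', ∑ i', g (i, j) (i', j') :=
          Finset.sum_congr rfl fun j _ => Finset.sum_comm
      _ = ∑ j', ∑ j, ∑ i', g (i, j) (i', j') := Finset.sum_comm
      _ = ∑ j', ∑ i', ∑ j, g (i, j) (i', j') := Finset.sum_congr rfl fun j' _ => Finset.sum_comm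
  calc (∑ q : Fin k × Fin k', ∑ q' : Fin k × Fin k',
        ‖∑ κ : Fin n, ∑ ν : Fin n, ∑ μ : Fin n, ∑ μ' : Fin n,
          a q.1 (κ, μ) * b' q.2 (μ, ν) * conj (a q'.1 (κ, μ')) * conj (b' q'.2 (μ', ν))‖ ^ 2)
      = ∑ q : Fin k × Fin k', ∑ q' : Fin k × Fin k',
          ‖∑ x, conj (F (q'.1, q.2) x) * X (q.1, q'.2) x‖ ^ 2 := by
        refine Finset.sum_congr rfl fun q _ => Finset.sum_congr rfl fun q' _ => ?_
        rw [hid q q']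
    _ = ∑ i : Fin k, ∑ j' : Fin k', ∑ i' : Fin k, ∑ j : Fin k',
          ‖∑ x, conj (F (i', j) x) * X (i, j') x‖ ^ 2 :=
        hreindex (fun q q' => ‖∑ x, conj (F (q'.1, q.2) x) * X (q.1, q'.2) x‖ ^ 2)
    _ ≤ ∑ _i : Fin k, ∑ _j' : Fin k', (1 : ℝ) := by
        refine Finset.sum_le_sum fun i _ => Finset.sum_le_sum fun j' _ => ?_
        calc ∑ i' : Fin k, ∑ j : Fin k', ‖∑ x, conj (F (i', j) x) * X (i, j') x‖ ^ 2
            ≤ ∑ x, ‖X (i, j') x‖ ^ 2 := sepMajorantFB_bessel F hFon (X (i, j'))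
          _ = 1 := hXn i j'
    _ = (k : ℝ) * (k' : ℝ) := by
        simp only [Finset.sum_const, Finset.card_univ, Fintype.card_fin, nsmul_eq_mul, mul_one]

end Summit.MatrixMultiplication.MatrixMultiplication.Theorems
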